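import Summits.ABC.ABC.Theses.IneffectiveSubspace
import Summits.ABC.ABC.Theorems.TowerExponentWindow.Negative.StubBinomialDepthWindowFloors
import Literature.NumberTheory.DiophantineGeometry.AbcImpliesHall

/-!
# `TowerExponentWindow` (stmt-ABC-1647) — negative-side lemmas IV: floor `C ≥ 2` for the lever of line
`binomial-xi-d-zero-threefold` at every even level

Deep-refute (drefute) output, companion of `StubsLoadBearing.lean`.  The lever (registered stub
`stub_binomialDepthWindow`) is `∃ n C C', 0 ≤ C ∧ 3C < n ∧ Depth(n, C, C')` with `Depth` the binomial depth
inequality spelled out verbatim below.  Landed so far (`StubBinomialDepthWindowFloors.lean`, cdisprove): `C ≥ 1` at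
every level, `C ≥ 2` at the levels divisible by `4` (Gaussian norm form) or by `6` (Eisenstein norm form).  Here:

* `two_le_of_depth_even` — **`C ≥ 2` at EVERY even level `n ≥ 2`**, by an elementary two-prime family that needs no
  norm form: for `l ≥ 1` let `3^k < 5^l < 3^(k+1)` and `a = (5^l + 3^k)/2`, `c = (5^l − 3^k)/2`; then `gcd(a, c) = 1`,
  `d := 3^k·5^l = (a − c)(a + c) = a² − c² ∣ aⁿ − cⁿ`, and the depth `log d > 2 l log 5 − log 3` is twice the height
  `log max(a, c) ≤ l log 5` up to `O(1)` (`rad d = 15`).  New cases: `n ≡ 2 (mod 4)` with `3 ∤ n` (`n = 2, 10, 14, 22, …`).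
  Consequently the natural strengthening "the lever with a constant `C < 2`" is refuted at all even levels; with the
  Padé floor `2 − 1/n` at odd levels (TRIAGE-r1-3, paper) and the birthday heuristic (Disproof.lean (d)), the expected
  threshold is `C = 2` at every level, so a witness of the lever has `n ≥ 7` and `C ∈ [2, n/3)`.

Refuter seat drefute-stmt-ABC-1647 (2026-08-16).
-/

namespace Summit.ABC.ABC.Theorems.TowerExponentWindow.Negative

open Literature.NumberTheory.DiophantineGeometry (radical_le_of_dvd_pow)

/-- **`C ≥ 2` at every even level `n ≥ 2`.**  For `l ≥ 1` let `3^k < 5^l < 3^(k+1)` and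
`a = (5^l + 3^k)/2`, `c = (5^l − 3^k)/2` (coprime, `a + c = 5^l`, `a − c = 3^k`); then
`d = 3^k·5^l = a² − c² ∣ aⁿ − cⁿ`, with depth `log d > 2 l log 5 − log 3` against heights
`log max(1,1) + log max(a,c) + log rad d ≤ 0 + l log 5 + log 15`.  So the strengthening of the lever to a
constant `C < 2` is refuted at all even levels (at the levels `4 ∣ n`, `6 ∣ n` this is the landed
`two_le_of_depth_four_dvd` / `two_le_of_depth_six_dvd`; new are the levels `n ≡ 2 (mod 4)`, `3 ∤ n`). [folklore] -/
theorem two_le_of_depth_even {n : ℕ} (hn : n ≠ 0) (h2 : 2 ∣ n) {C C' : ℝ} (hC : 0 ≤ C)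
    (h : ∀ a₁ a₂ c₁ c₂ : ℕ, 0 < a₁ → 0 < a₂ → 0 < c₁ → 0 < c₂ → Nat.Coprime (a₁ * a₂) (c₁ * c₂) →
      a₁ * a₂ ^ n ≠ c₁ * c₂ ^ n → ∀ d : ℕ, 0 < d → (d : ℤ) ∣ ((a₁ * a₂ ^ n : ℕ) : ℤ) - ((c₁ * c₂ ^ n : ℕ) : ℤ) →
      Real.log (d : ℝ) ≤ C * (Real.log ((max a₁ c₁ : ℕ) : ℝ) + Real.log ((max a₂ c₂ : ℕ) : ℝ) +
        Real.log ((UniqueFactorizationMonoid.radical d : ℕ) : ℝ)) + C') :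
    2 ≤ C := by
  obtain ⟨j, rfl⟩ := h2
  have hj : j ≠ 0 := by rintro rfl; exact hn rfl
  have hlog3 : 0 < Real.log 3 := Real.log_pos (by norm_num)
  have hlog5 : 0 < Real.log 5 := Real.log_pos (by norm_num)
  have key := depth_floor_of_families hC h (p := 2) (q := 1) (r := Real.log 3 / 2 + Real.log 15)
    (fun m => ((m : ℝ) + 1) * Real.log 5 - Real.log 3 / 2) (fun K => ?_) (fun m => ?_)
  · linarith
  · obtain ⟨m, hm⟩ := exists_nat_ge ((K + Real.log 3 / 2) / Real.log 5)
    refine ⟨m, ?_⟩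
    have := (div_le_iff₀ hlog5).mp hm
    nlinarith
  · -- the parameter: `P = 5^(m+1)`, `T = 3^k` with `k = log₃ P`, so `T < P < 3T`
    have hP0 : 5 ^ (m + 1) ≠ 0 := by positivity
    have hTP : 3 ^ Nat.log 3 (5 ^ (m + 1)) ≤ 5 ^ (m + 1) := Nat.pow_log_le_self 3 hP0
    have hP3T : 5 ^ (m + 1) < 3 ^ (Nat.log 3 (5 ^ (m + 1)) + 1) := Nat.lt_pow_succ_log_self (by norm_num) _
    generalize Nat.log 3 (5 ^ (m + 1)) = k at hTP hP3T
    have h5le : 5 ≤ 5 ^ (m + 1) := Nat.le_self_pow (by omega) 5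
    have hne35 : 3 ^ k ≠ 5 ^ (m + 1) := by
      intro he
      rcases Nat.eq_zero_or_pos k with hk0 | hk0
      · rw [hk0, pow_zero] at he
        omega
      · have h3 : 3 ∣ 5 ^ (m + 1) := he ▸ dvd_pow_self 3 hk0.ne'
        have := (Nat.prime_dvd_prime_iff_eq Nat.prime_three (by norm_num : Nat.Prime 5)).mp
          (Nat.Prime.dvd_of_dvd_pow Nat.prime_three h3)
        omega
    have hTP' : 3 ^ k < 5 ^ (m + 1) := lt_of_le_of_ne hTP hne35
    -- parity: both odd, so sum and difference are even
    have hodd5 : Odd (5 ^ (m + 1)) := Odd.pow (by decide)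
    have hodd3 : Odd (3 ^ k) := Odd.pow (by decide)
    obtain ⟨a, ha⟩ := Odd.add_odd hodd5 hodd3
    obtain ⟨c, hc⟩ := Nat.Odd.sub_odd hodd5 hodd3
    -- linear bookkeeping on the atoms `P`, `T`
    have hk1 : 1 ≤ 3 ^ k := Nat.one_le_pow _ _ (by norm_num)
    have hac : a + c = 5 ^ (m + 1) ∧ a = c + 3 ^ k := by
      generalize 5 ^ (m + 1) = P at *
      generalize 3 ^ k = T at *
      omega
    obtain ⟨hsum, hdiff⟩ := hac
    have hcpos : 0 < c := by
      generalize 5 ^ (m + 1) = P at *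
      generalize 3 ^ k = T at *
      omega
    have hapos : 0 < a := by omega
    have hca : c < a := by omega
    -- coprimality: `gcd(a, c) ∣ gcd(5^l, 3^k) = 1`
    have hcop : Nat.Coprime a c := by
      have h53 : Nat.Coprime (5 ^ (m + 1)) (3 ^ k) := Nat.Coprime.pow _ _ (by norm_num)
      have hg5 : Nat.gcd a c ∣ 5 ^ (m + 1) := by
        rw [← hsum]; exact Nat.dvd_add (Nat.gcd_dvd_left a c) (Nat.gcd_dvd_right a c)
      have hg3 : Nat.gcd a c ∣ 3 ^ k := by
        have e : 3 ^ k = a - c := by omega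
        rw [e]; exact Nat.dvd_sub (Nat.gcd_dvd_left a c) (Nat.gcd_dvd_right a c)
      exact Nat.eq_one_of_dvd_coprimes h53 hg5 hg3
    -- real-side sizes
    have hk3 : ((m : ℝ) + 1) * Real.log 5 < ((k : ℝ) + 1) * Real.log 3 := by
      have h1 : ((5 ^ (m + 1) : ℕ) : ℝ) < ((3 ^ (k + 1) : ℕ) : ℝ) := by exact_mod_cast hP3T
      have h2 := Real.log_lt_log (by positivity) h1
      push_cast at h2
      rw [Real.log_pow, Real.log_pow] at h2
      push_cast at h2
      linarith
    have hlogd : Real.log ((3 ^ k * 5 ^ (m + 1) : ℕ) : ℝ) = (k : ℝ) * Real.log 3 + ((m : ℝ) + 1) * Real.log 5 := by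
      push_cast
      rw [Real.log_mul (by positivity) (by positivity), Real.log_pow, Real.log_pow]
      push_cast; ring
    have ha5 : a ≤ 5 ^ (m + 1) := by omega
    have hloga : Real.log (a : ℝ) ≤ ((m : ℝ) + 1) * Real.log 5 := by
      have h1 : (a : ℝ) ≤ (5 : ℝ) ^ (m + 1) := by exact_mod_cast ha5
      calc Real.log (a : ℝ) ≤ Real.log ((5 : ℝ) ^ (m + 1)) := Real.log_le_log (by exact_mod_cast hapos) h1
        _ = ((m : ℝ) + 1) * Real.log 5 := by rw [Real.log_pow]; push_cast; ring
    have hrad : UniqueFactorizationMonoid.radical (3 ^ k * 5 ^ (m + 1)) ≤ 15 := by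
      refine radical_le_of_dvd_pow (n := k + (m + 1)) (by norm_num) ?_
      rw [show (15 : ℕ) = 3 * 5 by norm_num, mul_pow]
      exact mul_dvd_mul (Nat.pow_dvd_pow 3 (by omega)) (Nat.pow_dvd_pow 5 (by omega))
    have hrad' : Real.log ((UniqueFactorizationMonoid.radical (3 ^ k * 5 ^ (m + 1)) : ℕ) : ℝ) ≤ Real.log 15 :=
      Real.log_le_log (by exact_mod_cast Nat.radical_pos _) (by exact_mod_cast hrad)
    -- the admissible datum
    refine ⟨1, a, 1, c, 3 ^ k * 5 ^ (m + 1), one_pos, hapos, one_pos, hcpos, by positivity,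
      by simpa using hcop, ?_, ?_, ?_, ?_⟩
    · rw [one_mul, one_mul]
      exact (Nat.pow_lt_pow_left hca (by omega)).ne'
    · have h1 : (a : ℤ) = c + 3 ^ k := by exact_mod_cast hdiff
      have h2 : (a : ℤ) + c = 5 ^ (m + 1) := by exact_mod_cast hsum
      have e : ((3 ^ k * 5 ^ (m + 1) : ℕ) : ℤ) = (a : ℤ) ^ 2 - (c : ℤ) ^ 2 := by
        push_cast
        rw [← h2, h1]; ring
      rw [e]; push_cast; rw [one_mul, one_mul, pow_mul, pow_mul]
      exact sub_dvd_pow_sub_pow _ _ j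
    · rw [hlogd]; linarith
    · rw [max_self, max_eq_left hca.le, Nat.cast_one, Real.log_one, zero_add]
      linarith

end Summit.ABC.ABC.Theorems.TowerExponentWindow.Negative
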